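import Summits.CriticalPhenomena.PercolationContinuityZ3.Theorems.PercNearOneGluingNoHeavyLowerTailFrontierDecRowsCutSetup
import Summits.CriticalPhenomena.PercolationContinuityZ3.Theorems.PercNearOneGluingNoHeavyLowerTailFrontierDecRowsCutMeasure
import Summits.CriticalPhenomena.PercolationContinuityZ3.Theorems.PercNearOneGluingNoHeavyLowerTailFrontierDecRowsLeFive
import Mathlib.Tactic.Linarith
import HarnessLib

/-!
# Frontier dec row 15 `E₃(D[ab|c], D[ac|y], D[b|y])` across a cut vertex isolating the terminal `b`: three Harris brackets

Support file for crux `stmt-CriticalPhenomena-4575` (four-point decreasing `E₃` frontier), seat `prim-l12-p6` gen 16; memo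
`run/shared/lean/prim/prim-l12/FROM-prim-l12-p6-g16-ROW37-HUB-IDENTITY.md` §3.  No definitions, no named facts, no sorries.

Row 15 across a cut vertex `h` separating `b` (colour `false`) from `a, c, y` (colour `true`); `ρ = P(h ↔ b on the far side)`.  Only `D[ab|c]`
and `D[b|y]` see the far side, so Sahi's functional is QUADRATIC in `ρ`.  With the near-side events `A = {a≁c}`, `Z = D[ac|y]`, `Hc = {c↔h}`,
`Hy = {y↔h}`:  `D[ab|c] = A ∖ (Hc ∧ B)`, `D[ac|y] = Z`, `D[b|y] = (Hy ∧ B)ᶜ`, and EXACTLY (symbolic identity over the 15 cells of the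
near-side law; read off a 3-bracket LP certificate, kit j144974/j150372)
  **`E₃ = (1−ρ)²·Cov(A,Z) + ρ(1−ρ)·[Cov(A, Z∩Hyᶜ) + P(Hy)·Cov(A,Z) + Cov(Z, A∩Hcᶜ∩Hyᶜ)] + ρ²·row 15 at (a,h,c,y)`**
(the one set input is `A ∩ Z ∩ (Hc ∪ Hy) = (A ∩ Z ∩ Hc) ⊔ (A ∩ Z ∩ Hy)`).  The three covariances are of decreasing events (Harris).
THEOREM (`sahiE3_row15_nonneg_of_threeOneCut_b`): row 15 at `(a,h,c,y)` implies row 15 at `(a,b,c,y)` across such a cut.  With gen 15's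
`…Row15ThreeOneCutA` (lone `a`), `…Row15ThreeOneCutY` (lone `y`) and `…Row15ThreeOneCutC` (lone `c`, this generation) every `3|1` cut of row 15 is covered.
-/

noncomputable section

namespace Summit.CriticalPhenomena.PercolationContinuityZ3.Theorems.FrontierDecRows

open MeasureTheory CovTransferCert E3GroupSepCert
open Literature.Probability.Percolation Literature.Probability.LatticeModels

variable {n : ℕ}

/-- The row-15 lone-`b` pencil in real variables (`r = P(h ↔ b)`; `a = P(A)`, `z = P(Z)`, `hy = P(Hy)`, joint masses as named). [this work] -/
theorem row15_threeOneCutB_ineq (r a z hy az aHc aU zHy azHc azHy azU : ℝ) (hr0 : 0 ≤ r) (hr1 : r ≤ 1) (hhy : 0 ≤ hy)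
    (hazU : azU = azHc + azHy)
    (H1 : a * (z - zHy) ≤ az - azHy) (H2 : z * (a - aU) ≤ az - azU) (H3 : a * z ≤ az)
    (h15 : 0 ≤ 2 * (az - azU) + (a - aHc) * z * (1 - hy) - ((a - aHc) * (z - zHy) + z * (a - aU) + (1 - hy) * (az - azHc))) :
    0 ≤ 2 * (az - azU * r) + (a - aHc * r) * z * (1 - hy * r) -
      ((a - aHc * r) * (z - zHy * r) + z * (a - aU * r) + (1 - hy * r) * (az - azHc * r)) := by
  subst hazU
  have key : 2 * (az - (azHc + azHy) * r) + (a - aHc * r) * z * (1 - hy * r) -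
      ((a - aHc * r) * (z - zHy * r) + z * (a - aU * r) + (1 - hy * r) * (az - azHc * r)) =
      (1 - r) ^ 2 * (az - a * z) +
      r * (1 - r) * ((az - azHy - a * (z - zHy)) + hy * (az - a * z) + ((az - (azHc + azHy)) - z * (a - aU))) +
      r ^ 2 * (2 * (az - (azHc + azHy)) + (a - aHc) * z * (1 - hy) - ((a - aHc) * (z - zHy) + z * (a - aU) + (1 - hy) * (az - azHc))) := by
    ring
  rw [key]
  have h1r : 0 ≤ 1 - r := sub_nonneg.2 hr1
  have t1 := mul_nonneg (sq_nonneg (1 - r)) (sub_nonneg.2 H3)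
  have t2 : 0 ≤ (az - azHy - a * (z - zHy)) + hy * (az - a * z) + ((az - (azHc + azHy)) - z * (a - aU)) := by
    have := mul_nonneg hhy (sub_nonneg.2 H3)
    linarith
  have t3 := mul_nonneg (mul_nonneg hr0 h1r) t2
  have t4 := mul_nonneg (sq_nonneg r) h15
  linarith

set_option maxHeartbeats 1600000 in
/-- **Row 15 across a cut vertex isolating `b`.**  `a, c, y` coloured `true`, `b` coloured `false`, every positive-weight edge avoiding `h`
monochromatic: row 15 at `(a,h,c,y)` implies row 15 at `(a,b,c,y)` (quadratic pencil; three Harris brackets + IH). [this work] -/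
theorem sahiE3_row15_nonneg_of_threeOneCut_b (w : Sym2 (Fin n) → unitInterval) (a b c y h : Fin n) (side : Fin n → Bool)
    (ha : side a = true) (hc : side c = true) (hy : side y = true) (hb : side b = false)
    (hw : ∀ u v : Fin n, u ≠ h → v ≠ h → side u ≠ side v → w s(u, v) = 0)
    (h15 : 0 ≤ sahiE3 (prodBernoulli w) (connEvent (row 15 n (a, h, c, y)).1) (connEvent (row 15 n (a, h, c, y)).2.1)
      (connEvent (row 15 n (a, h, c, y)).2.2)) :
    0 ≤ sahiE3 (prodBernoulli w) (connEvent (row 15 n (a, b, c, y)).1) (connEvent (row 15 n (a, b, c, y)).2.1)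
      (connEvent (row 15 n (a, b, c, y)).2.2) := by
  classical
  have hrow : row 15 n (a, b, c, y) = (sep [a, b] [c], sep [a, c] [y], sep [b] [y]) := rfl
  have hrow' : row 15 n (a, h, c, y) = (sep [a, h] [c], sep [a, c] [y], sep [h] [y]) := rfl
  simp only [hrow, connEvent_sep]
  simp only [hrow', connEvent_sep] at h15
  set μ := prodBernoulli w with hμ
  have neB : ∀ x, side x = true → x ≠ b := fun x hx e => by rw [e, hb] at hx; exact Bool.false_ne_true hx
  obtain ⟨hab, hcb, hyb⟩ : a ≠ b ∧ c ≠ b ∧ y ≠ b := ⟨neB a ha, neB c hc, neB y hy⟩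
  set F₁ : Finset (Sym2 (Fin n)) := Finset.univ.filter (fun e => ∀ u ∈ e, side u = true ∨ u = h) with hF₁
  set F₂ : Finset (Sym2 (Fin n)) :=
    Finset.univ.filter (fun e => (∀ u ∈ e, side u = false ∨ u = h) ∧ ¬ ∀ u ∈ e, u = h) with hF₂
  have hdisj : Disjoint F₁ F₂ := cutSides_disjoint side h F₁ F₂ hF₁ hF₂
  set D : Finset (Sym2 (Fin n)) := F₁ ∪ F₂ with hD
  have hwD : ∀ e, e ∉ D → w e = 0 := fun e he => cutSides_weight_zero w side h F₁ F₂ hF₁ hF₂ hw e (by rwa [hD] at he)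
  have pl : ∀ ω : Set (Sym2 (Fin n)), ∀ x z, side x = true → side z = true →
      ((openGraph (ω ∩ ↑D)).Reachable x z ↔ (openGraph (ω ∩ ↑F₁)).Reachable x z) := by
    intro ω x z hx hz; rw [hD]; exact cutSides_reach_left side h F₁ F₂ hF₁ hF₂ ω x z hx hz
  have plh : ∀ ω : Set (Sym2 (Fin n)), ∀ x, side x = true →
      ((openGraph (ω ∩ ↑D)).Reachable x h ↔ (openGraph (ω ∩ ↑F₁)).Reachable x h) := by
    intro ω x hx; rw [hD]; exact cutSides_reach_h side h F₁ F₂ hF₁ hF₂ ω x hx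
  have pc : ∀ ω : Set (Sym2 (Fin n)), ∀ x, side x = true → x ≠ b →
      ((openGraph (ω ∩ ↑D)).Reachable x b ↔
        (openGraph (ω ∩ ↑F₁)).Reachable x h ∧ (openGraph (ω ∩ ↑F₂)).Reachable h b) := by
    intro ω x hx hxb; rw [hD, SimpleGraph.reachable_comm]; exact cutSides_reach_cross side h F₁ F₂ hF₁ hF₂ ω x b hx hb hxb
  -- near-side events
  set A : Set (Set (Sym2 (Fin n))) := {ω | ω ∩ ↑F₁ ∈ ((openConn a c)ᶜ : Set (Set (Sym2 (Fin n))))} with hA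
  set Eay : Set (Set (Sym2 (Fin n))) := {ω | ω ∩ ↑F₁ ∈ ((openConn a y)ᶜ : Set (Set (Sym2 (Fin n))))} with hEay
  set Ecy : Set (Set (Sym2 (Fin n))) := {ω | ω ∩ ↑F₁ ∈ ((openConn c y)ᶜ : Set (Set (Sym2 (Fin n))))} with hEcy
  set Hc : Set (Set (Sym2 (Fin n))) := {ω | ω ∩ ↑F₁ ∈ (openConn c h : Set (Set (Sym2 (Fin n))))} with hHc
  set Hy : Set (Set (Sym2 (Fin n))) := {ω | ω ∩ ↑F₁ ∈ (openConn y h : Set (Set (Sym2 (Fin n))))} with hHy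
  set EB : Set (Set (Sym2 (Fin n))) := {ω | ω ∩ ↑F₂ ∈ (openConn h b : Set (Set (Sym2 (Fin n))))} with hEB
  set X : Set (Set (Sym2 (Fin n))) := {ω | ∀ x ∈ [a, b], ∀ z ∈ [c], ω ∉ openConn x z} with hX
  set Y : Set (Set (Sym2 (Fin n))) := {ω | ∀ x ∈ [a, c], ∀ z ∈ [y], ω ∉ openConn x z} with hY
  set Zg : Set (Set (Sym2 (Fin n))) := {ω | ∀ x ∈ [b], ∀ z ∈ [y], ω ∉ openConn x z} with hZg
  have tX : {ω : Set (Sym2 (Fin n)) | ω ∩ ↑D ∈ X} = A \ ((A ∩ Hc) ∩ EB) := by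
    ext ω
    simp only [hX, hA, hHc, hEB, Set.mem_setOf_eq, Set.mem_sdiff, Set.mem_inter_iff, Set.mem_compl_iff, openConn, List.mem_cons,
      List.mem_nil_iff, or_false, forall_eq_or_imp, forall_eq]
    rw [pl ω a c ha hc, SimpleGraph.reachable_comm (u := b), pc ω c hc hcb]
    tauto
  have tY : {ω : Set (Sym2 (Fin n)) | ω ∩ ↑D ∈ Y} = Eay ∩ Ecy := by
    ext ω
    simp only [hY, hEay, hEcy, Set.mem_setOf_eq, Set.mem_inter_iff, Set.mem_compl_iff, openConn, List.mem_cons, List.mem_nil_iff,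
      or_false, forall_eq_or_imp, forall_eq]
    rw [pl ω a y ha hy, pl ω c y hc hy]
  have tZ : {ω : Set (Sym2 (Fin n)) | ω ∩ ↑D ∈ Zg} = (Hy ∩ EB)ᶜ := by
    ext ω
    simp only [hZg, hHy, hEB, Set.mem_setOf_eq, Set.mem_compl_iff, Set.mem_inter_iff, openConn, List.mem_singleton, forall_eq]
    rw [SimpleGraph.reachable_comm (u := b), pc ω y hy hyb]
  have tS : ∀ (x z : Fin n), side x = true → side z = true →
      {ω : Set (Sym2 (Fin n)) | ω ∩ ↑D ∈ {ω : Set (Sym2 (Fin n)) | ∀ p ∈ [x], ∀ q ∈ [z], ω ∉ openConn p q}} =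
        {ω | ω ∩ ↑F₁ ∈ ((openConn x z)ᶜ : Set (Set (Sym2 (Fin n))))} := by
    intro x z hx hz; ext ω
    simp only [Set.mem_setOf_eq, List.mem_singleton, forall_eq, Set.mem_compl_iff, openConn]
    exact not_congr (pl ω x z hx hz)
  set Sahc : Set (Set (Sym2 (Fin n))) := {ω | ∀ p ∈ [a, h], ∀ q ∈ [c], ω ∉ openConn p q} with hSahc
  set Shy : Set (Set (Sym2 (Fin n))) := {ω | ∀ p ∈ [h], ∀ q ∈ [y], ω ∉ openConn p q} with hShy
  have tXh : {ω : Set (Sym2 (Fin n)) | ω ∩ ↑D ∈ Sahc} = A ∩ Hcᶜ := by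
    ext ω
    simp only [hSahc, hA, hHc, Set.mem_setOf_eq, Set.mem_inter_iff, Set.mem_compl_iff, openConn, List.mem_cons, List.mem_nil_iff,
      or_false, forall_eq_or_imp, forall_eq]
    rw [pl ω a c ha hc, SimpleGraph.reachable_comm (u := h), plh ω c hc]
  have tWh : {ω : Set (Sym2 (Fin n)) | ω ∩ ↑D ∈ Shy} = Hyᶜ := by
    ext ω
    simp only [hShy, hHy, Set.mem_setOf_eq, Set.mem_compl_iff, openConn, List.mem_singleton, forall_eq]
    rw [SimpleGraph.reachable_comm (u := h), plh ω y hy]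
  have thin : ∀ S : Set (Set (Sym2 (Fin n))), μ.real S = μ.real {ω | ω ∩ ↑D ∈ S} :=
    fun S => real_eq_real_setOf_inter_mem w D hwD S
  have pre_inter : ∀ P Q : Set (Set (Sym2 (Fin n))),
      {ω : Set (Sym2 (Fin n)) | ω ∩ ↑D ∈ P ∩ Q} = {ω | ω ∩ ↑D ∈ P} ∩ {ω | ω ∩ ↑D ∈ Q} := fun P Q => rfl
  have ms : ∀ S : Set (Set (Sym2 (Fin n))), MeasurableSet S := fun S => (Set.toFinite _).measurableSet
  have detB : DeterminedBy EB (↑F₁ : Set (Sym2 (Fin n)))ᶜ := by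
    rw [determinedBy_iff]
    intro ω ω' hω
    have hsub : (↑F₂ : Set (Sym2 (Fin n))) ⊆ (↑F₁ : Set (Sym2 (Fin n)))ᶜ := fun e he he1 =>
      Finset.disjoint_left.1 hdisj (Finset.mem_coe.1 he1) (Finset.mem_coe.1 he)
    have : ω ∩ ↑F₂ = ω' ∩ ↑F₂ := by
      rw [← Set.inter_eq_self_of_subset_right hsub, ← Set.inter_assoc, ← Set.inter_assoc, hω]
    simp only [hEB, Set.mem_setOf_eq, this]
  have indep : ∀ S : Set (Set (Sym2 (Fin n))), (∀ ω ω' : Set (Sym2 (Fin n)), ω ∩ ↑F₁ = ω' ∩ ↑F₁ → (ω ∈ S ↔ ω' ∈ S)) →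
      μ.real (S ∩ EB) = μ.real S * μ.real EB :=
    fun S hS => prodBernoulli_real_inter_of_determinedBy w F₁ ((determinedBy_iff S _).2 hS) detB (ms _) (ms _)
  have sd : ∀ S : Set (Set (Sym2 (Fin n))), (∃ P : Set (Set (Sym2 (Fin n))), S = {ω | ω ∩ ↑F₁ ∈ P}) →
      ∀ ω ω' : Set (Sym2 (Fin n)), ω ∩ ↑F₁ = ω' ∩ ↑F₁ → (ω ∈ S ↔ ω' ∈ S) := by
    rintro S ⟨P, rfl⟩ ω ω' hω; simp only [Set.mem_setOf_eq, hω]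
  have mC : ∀ S H : Set (Set (Sym2 (Fin n))), μ.real (S ∩ Hᶜ) = μ.real S - μ.real (S ∩ H) := real_inter_compl μ ms
  have cpl : ∀ S : Set (Set (Sym2 (Fin n))), μ.real Sᶜ = 1 - μ.real S := by
    intro S; rw [Set.compl_eq_univ_sdiff, measureReal_sdiff (Set.subset_univ _) (ms _)]; simp [hμ]
  -- the glued probabilities (`U = Hc ∪ Hy`)
  have eX : μ.real X = μ.real A - μ.real (A ∩ Hc) * μ.real EB := by
    rw [thin, tX]; exact real_sdiff_block₁ μ ms A Hc EB (indep _ (sd _ ⟨(openConn a c)ᶜ ∩ openConn c h, rfl⟩))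
  have eY : μ.real Y = μ.real (Eay ∩ Ecy) := by rw [thin, tY]
  have eZ : μ.real Zg = 1 - μ.real Hy * μ.real EB := by
    rw [thin, tZ, cpl, indep Hy (sd _ ⟨openConn y h, rfl⟩)]
  have eXY : μ.real (X ∩ Y) = μ.real (A ∩ (Eay ∩ Ecy)) - μ.real (A ∩ (Eay ∩ Ecy) ∩ Hc) * μ.real EB := by
    rw [thin, pre_inter, tX, tY]
    have e : A \ ((A ∩ Hc) ∩ EB) ∩ (Eay ∩ Ecy) = (A ∩ (Eay ∩ Ecy)) \ (((A ∩ (Eay ∩ Ecy)) ∩ Hc) ∩ EB) := by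
      ext ω; simp only [Set.mem_sdiff, Set.mem_inter_iff]; tauto
    rw [e]; exact real_sdiff_block₁ μ ms _ Hc EB (indep _ (sd _ ⟨(openConn a c)ᶜ ∩ ((openConn a y)ᶜ ∩ (openConn c y)ᶜ) ∩ openConn c h, rfl⟩))
  have eXZ : μ.real (X ∩ Zg) = μ.real A - μ.real (A ∩ (Hc ∪ Hy)) * μ.real EB := by
    rw [thin, pre_inter, tX, tZ]
    have e : A \ ((A ∩ Hc) ∩ EB) ∩ (Hy ∩ EB)ᶜ = A \ ((A ∩ (Hc ∪ Hy)) ∩ EB) := by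
      ext ω; simp only [Set.mem_sdiff, Set.mem_inter_iff, Set.mem_compl_iff, Set.mem_union]; tauto
    rw [e]; exact real_sdiff_block₁ μ ms A _ EB (indep _ (sd _ ⟨(openConn a c)ᶜ ∩ (openConn c h ∪ openConn y h), rfl⟩))
  have eYZ : μ.real (Y ∩ Zg) = μ.real (Eay ∩ Ecy) - μ.real ((Eay ∩ Ecy) ∩ Hy) * μ.real EB := by
    rw [thin, pre_inter, tY, tZ]
    have e : (Eay ∩ Ecy) ∩ (Hy ∩ EB)ᶜ = (Eay ∩ Ecy) \ (((Eay ∩ Ecy) ∩ Hy) ∩ EB) := by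
      ext ω; simp only [Set.mem_sdiff, Set.mem_inter_iff, Set.mem_compl_iff]; tauto
    rw [e]; exact real_sdiff_block₁ μ ms _ _ EB (indep _ (sd _ ⟨((openConn a y)ᶜ ∩ (openConn c y)ᶜ) ∩ openConn y h, rfl⟩))
  have eXYZ : μ.real (X ∩ Y ∩ Zg) = μ.real (A ∩ (Eay ∩ Ecy)) - μ.real (A ∩ (Eay ∩ Ecy) ∩ (Hc ∪ Hy)) * μ.real EB := by
    rw [thin, pre_inter, pre_inter, tX, tY, tZ]
    have e : A \ ((A ∩ Hc) ∩ EB) ∩ (Eay ∩ Ecy) ∩ (Hy ∩ EB)ᶜ = (A ∩ (Eay ∩ Ecy)) \ (((A ∩ (Eay ∩ Ecy)) ∩ (Hc ∪ Hy)) ∩ EB) := by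
      ext ω; simp only [Set.mem_sdiff, Set.mem_inter_iff, Set.mem_compl_iff, Set.mem_union]; tauto
    rw [e]; exact real_sdiff_block₁ μ ms _ _ EB
      (indep _ (sd _ ⟨(openConn a c)ᶜ ∩ ((openConn a y)ᶜ ∩ (openConn c y)ᶜ) ∩ (openConn c h ∪ openConn y h), rfl⟩))
  -- the hypothesis: row 15 at (a,h,c,y) = E₃(A ∩ Hcᶜ, Z, Hyᶜ)
  set Z : Set (Set (Sym2 (Fin n))) := Eay ∩ Ecy with hZ
  have m1 : ∀ P S : Set (Set (Sym2 (Fin n))), {ω : Set (Sym2 (Fin n)) | ω ∩ ↑D ∈ P} = S → μ.real P = μ.real S := by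
    intro P S hPS; rw [thin, hPS]
  rw [sahiE3_def] at h15
  have v0 : μ.real (Sahc ∩ Y ∩ Shy) = μ.real ((A ∩ Hcᶜ) ∩ Z ∩ Hyᶜ) := m1 _ _ (by rw [pre_inter, pre_inter, tXh, tY, tWh])
  have v1 : μ.real Sahc = μ.real (A ∩ Hcᶜ) := m1 _ _ tXh
  have v2 : μ.real Y = μ.real Z := m1 _ _ tY
  have v3 : μ.real Shy = μ.real Hyᶜ := m1 _ _ tWh
  have v4 : μ.real (Y ∩ Shy) = μ.real (Z ∩ Hyᶜ) := m1 _ _ (by rw [pre_inter, tY, tWh])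
  have v5 : μ.real (Sahc ∩ Shy) = μ.real ((A ∩ Hcᶜ) ∩ Hyᶜ) := m1 _ _ (by rw [pre_inter, tXh, tWh])
  have v6 : μ.real (Sahc ∩ Y) = μ.real ((A ∩ Hcᶜ) ∩ Z) := m1 _ _ (by rw [pre_inter, tXh, tY])
  rw [v0, v1, v2, v3, v4, v5, v6] at h15
  -- set input: `Hc`, `Hy` are disjoint on `Z`
  have djZ : ∀ ω, ω ∈ Z → ω ∈ Hc → ω ∈ Hy → False := by
    intro ω hz hhc hhy
    simp only [hZ, hEay, hEcy, hHc, hHy, Set.mem_inter_iff, Set.mem_setOf_eq, Set.mem_compl_iff, openConn] at hz hhc hhy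
    exact hz.2 (hhc.trans hhy.symm)
  have sU : μ.real (A ∩ Z ∩ (Hc ∪ Hy)) = μ.real (A ∩ Z ∩ Hc) + μ.real (A ∩ Z ∩ Hy) := by
    rw [Set.inter_union_distrib_left]
    exact measureReal_union (Set.disjoint_left.2 fun ω h1 h2 => djZ ω h1.1.2 h1.2 h2.2) (ms _)
  have sW : μ.real ((A ∩ Hcᶜ) ∩ Hyᶜ) = μ.real A - μ.real (A ∩ (Hc ∪ Hy)) := by
    have e : (A ∩ Hcᶜ) ∩ Hyᶜ = A ∩ (Hc ∪ Hy)ᶜ := by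
      ext ω; simp only [Set.mem_inter_iff, Set.mem_compl_iff, Set.mem_union]; tauto
    rw [e, mC]
  have sZW : μ.real ((A ∩ Hcᶜ) ∩ Z ∩ Hyᶜ) = μ.real (A ∩ Z) - μ.real (A ∩ Z ∩ (Hc ∪ Hy)) := by
    have e : (A ∩ Hcᶜ) ∩ Z ∩ Hyᶜ = (A ∩ Z) ∩ (Hc ∪ Hy)ᶜ := by
      ext ω; simp only [Set.mem_inter_iff, Set.mem_compl_iff, Set.mem_union]; tauto
    rw [e, mC]
  have sXh : μ.real (A ∩ Hcᶜ) = μ.real A - μ.real (A ∩ Hc) := mC _ _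
  have sXZ : μ.real ((A ∩ Hcᶜ) ∩ Z) = μ.real (A ∩ Z) - μ.real (A ∩ Z ∩ Hc) := by
    have e : (A ∩ Hcᶜ) ∩ Z = (A ∩ Z) ∩ Hcᶜ := by ext ω; simp only [Set.mem_inter_iff, Set.mem_compl_iff]; tauto
    rw [e, mC]
  have sZWc : μ.real (Z ∩ Hyᶜ) = μ.real Z - μ.real (Z ∩ Hy) := mC _ _
  have sWc : μ.real Hyᶜ = 1 - μ.real Hy := cpl _
  rw [sZW, sXh, sWc, sZWc, sW, sXZ] at h15
  -- Harris inputs (all events decreasing on side 1)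
  have loConn : ∀ u v : Fin n, IsLowerSet {ω : Set (Sym2 (Fin n)) | ω ∩ ↑F₁ ∈ ((openConn u v)ᶜ : Set (Set (Sym2 (Fin n))))} := by
    intro u v ω ω' hle hω
    simp only [Set.mem_setOf_eq, Set.mem_compl_iff] at hω ⊢
    exact fun h' => hω (isUpperSet_openConn u v (Set.inter_subset_inter_left _ hle) h')
  have loHc : ∀ u : Fin n, IsLowerSet ({ω : Set (Sym2 (Fin n)) | ω ∩ ↑F₁ ∈ (openConn u h : Set (Set (Sym2 (Fin n))))}ᶜ) := by
    intro u ω ω' hle hω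
    simp only [Set.mem_compl_iff, Set.mem_setOf_eq] at hω ⊢
    exact fun h' => hω (isUpperSet_openConn u h (Set.inter_subset_inter_left _ hle) h')
  have loA : IsLowerSet A := loConn a c
  have loZ : IsLowerSet Z := (loConn a y).inter (loConn c y)
  have loU : IsLowerSet (Hc ∪ Hy)ᶜ := by
    have e : (Hc ∪ Hy)ᶜ = Hcᶜ ∩ Hyᶜ := by ext ω; simp only [Set.mem_compl_iff, Set.mem_union, Set.mem_inter_iff]; tauto
    rw [e]; exact (loHc c).inter (loHc y)
  have H1 := prodBernoulli_harris_lower w loA (loZ.inter (loHc y)) (ms _) (ms _)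
  have H2 := prodBernoulli_harris_lower w loZ (loA.inter loU) (ms _) (ms _)
  have H3 := prodBernoulli_harris_lower w loA loZ (ms _) (ms _)
  have e1 : μ.real (A ∩ (Z ∩ Hyᶜ)) = μ.real (A ∩ Z) - μ.real (A ∩ Z ∩ Hy) := by rw [← Set.inter_assoc, mC]
  have e2 : μ.real (Z ∩ (A ∩ (Hc ∪ Hy)ᶜ)) = μ.real (A ∩ Z) - μ.real (A ∩ Z ∩ (Hc ∪ Hy)) := by
    rw [← Set.inter_assoc, Set.inter_comm Z A, mC]
  have e4 : μ.real (A ∩ (Hc ∪ Hy)ᶜ) = μ.real A - μ.real (A ∩ (Hc ∪ Hy)) := mC _ _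
  rw [e1, sZWc] at H1
  rw [e2, e4] at H2
  have hρ0 : 0 ≤ μ.real EB := measureReal_nonneg
  have hρ1 : μ.real EB ≤ 1 := (measureReal_mono (Set.subset_univ EB)).trans (le_of_eq (by simp [hμ]))
  have hAZ : A ∩ (Eay ∩ Ecy) = A ∩ Z := by rw [hZ]
  rw [sahiE3_def, eXYZ, eX, eY, eZ, eYZ, eXZ, eXY, hAZ]
  exact row15_threeOneCutB_ineq (μ.real EB) (μ.real A) (μ.real Z) (μ.real Hy) (μ.real (A ∩ Z)) (μ.real (A ∩ Hc))
    (μ.real (A ∩ (Hc ∪ Hy))) (μ.real (Z ∩ Hy)) (μ.real (A ∩ Z ∩ Hc)) (μ.real (A ∩ Z ∩ Hy)) (μ.real (A ∩ Z ∩ (Hc ∪ Hy)))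
    hρ0 hρ1 measureReal_nonneg sU H1 H2 H3 h15

end Summit.CriticalPhenomena.PercolationContinuityZ3.Theorems.FrontierDecRows

end
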